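import Mathlib.NumberTheory.Padics.Complex
import Mathlib.RingTheory.PowerSeries.Basic
import HarnessLib

set_option linter.dupNamespace false -- `Summit.BirchSwinnertonDyer.BirchSwinnertonDyer.Theorems.…` (summit = sub)
set_option autoImplicit false

/-!
# Crux `EisensteinHeartFlatCMInertBadKPrime` (stmt-BirchSwinnertonDyer-21341), line `hsieh-lambda`: the ♭-heart's
# conclusion is blind to NON-ZERO CONSTANTS — `∃ m, p^m·I ⊆ (c·Q) ⟺ ∃ m, p^m·I ⊆ (Q)` for `c ∈ 𝓞_{ℂ_p} ∖ 0`

Route `BiquadraticEisensteinDescent` (cell `pub/bsd-wall`, lead `bsd-wall-cm-bed-p1` g0, D-0152 M1). The heart's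
conclusion `∃ m, ∀ x ∈ I, C(p)^m·x ∈ (Q)` in `𝓞_{ℂ_p}⟦T⟧` (vet bed4: invariant under `Q ↦ p^k·Q` and `Q ↦ unit·Q`)
is in fact invariant under `Q ↦ c·Q` for EVERY non-zero constant `c ∈ 𝓞_{ℂ_p}`: `𝓞_{ℂ_p}` is a (rank-one)
valuation ring, so `c ∣ p^k` for some `k` (`exists_dvd_natCast_pow`). This is the kernel piece the line's layer 2
(E1a: Katz–Hsieh factorisation of the any-level `𝒫_Σ(π_f,λ)²` on the `K′`-line, which holds only UP TO a non-zero
constant — a tame Gauss sum of positive valuation and a period ratio, HSIEH-AWAY-FROM-P-AUDIT.md (C3)) plugs into: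
equality of frames up to a non-zero constant transports the heart's conclusion (`heartShape_iff_of_C_mul`,
`heartShape_iff_of_span_C_mul_eq`, `heartShape_of_dvd_C_mul`; the shape is written out, no definition). THEOREMS ONLY (pure `𝓞_{ℂ_p}⟦T⟧` algebra); imports no `Theses` module; nothing about
the crux's input or any case of BSD is asserted. Supports stmt-BirchSwinnertonDyer-21341 as a helper.
-/

noncomputable section

open scoped NNReal

open PowerSeries

namespace Summit.BirchSwinnertonDyer.BirchSwinnertonDyer.Theorems.BiquadraticEisensteinDescentEisensteinHeartFlatCMInertBadKPrimeConstantScaling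

variable {p : ℕ} [Fact p.Prime]

/-- **Every non-zero `c ∈ 𝓞_{ℂ_p}` divides a power of `p`.** `𝓞_{ℂ_p}` is the valuation ring of the rank-one
valuation `v` of `ℂ_p` with `v(p) = 1/p < 1`; for `c ≠ 0` some `v(p)^k ≤ v(c)`, and `v(y) ≤ v(x)` means `x ∣ y` in
the ring of integers. [folklore] -/
theorem exists_dvd_natCast_pow {c : 𝓞_ℂ_[p]} (hc : c ≠ 0) : ∃ k : ℕ, c ∣ ((p : ℕ) : 𝓞_ℂ_[p]) ^ k := by
  have hp : p.Prime := Fact.out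
  have hv0 : 0 < Valued.v (c : ℂ_[p]) := by
    rw [Valuation.pos_iff]
    exact_mod_cast hc
  have hvp : Valued.v ((p : ℕ) : ℂ_[p]) = 1 / (p : ℝ≥0) := by
    have := PadicComplex.valuation_p p
    simpa using this
  have hlt : (1 / (p : ℝ≥0)) < 1 := by
    rw [one_div]
    exact inv_lt_one_of_one_lt₀ (by exact_mod_cast hp.one_lt)
  obtain ⟨k, hk⟩ := NNReal.exists_pow_lt_of_lt_one hv0 hlt
  refine ⟨k, (PadicComplexInt.integers p).dvd_of_le ?_⟩
  show Valued.v ((((p : ℕ) : 𝓞_ℂ_[p]) ^ k : 𝓞_ℂ_[p]) : ℂ_[p]) ≤ Valued.v (c : ℂ_[p])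
  push_cast
  rw [map_pow, hvp]
  exact hk.le

/-- **The heart's conclusion is blind to non-zero constants**: `(∃ m, p^m·I ⊆ (c·Q)) ⟺ (∃ m, p^m·I ⊆ (Q))` for
`c ∈ 𝓞_{ℂ_p} ∖ 0` (`⟹`: `(c·Q) ⊆ (Q)`; `⟸`: `c ∣ p^k`, so `p^{m+k}·x = (p^k/c)·c·p^m·x ∈ (c·Q)`). [folklore] -/
theorem heartShape_iff_of_C_mul {c : 𝓞_ℂ_[p]} (hc : c ≠ 0) (I : Ideal (PowerSeries 𝓞_ℂ_[p]))
    (Q : PowerSeries 𝓞_ℂ_[p]) :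
    (∃ m : ℕ, ∀ x ∈ I, (C ((p : ℕ) : 𝓞_ℂ_[p]) : PowerSeries 𝓞_ℂ_[p]) ^ m * x ∈ Ideal.span {C c * Q}) ↔
      (∃ m : ℕ, ∀ x ∈ I, (C ((p : ℕ) : 𝓞_ℂ_[p]) : PowerSeries 𝓞_ℂ_[p]) ^ m * x ∈ Ideal.span {Q}) := by
  constructor
  · rintro ⟨m, hm⟩
    refine ⟨m, fun x hx ↦ ?_⟩
    have h := hm x hx
    rw [Ideal.mem_span_singleton] at h ⊢
    obtain ⟨g, hg⟩ := h
    exact ⟨C c * g, by rw [hg]; ring⟩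
  · rintro ⟨m, hm⟩
    obtain ⟨k, d, hd⟩ := exists_dvd_natCast_pow (p := p) hc
    refine ⟨m + k, fun x hx ↦ ?_⟩
    have h := hm x hx
    rw [Ideal.mem_span_singleton] at h ⊢
    obtain ⟨g, hg⟩ := h
    refine ⟨C d * g, ?_⟩
    have hCd : (C ((p : ℕ) : 𝓞_ℂ_[p]) : PowerSeries 𝓞_ℂ_[p]) ^ k = C c * C d := by
      rw [← map_pow, ← map_mul, ← hd]
    calc (C ((p : ℕ) : 𝓞_ℂ_[p]) : PowerSeries 𝓞_ℂ_[p]) ^ (m + k) * x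
        = C ((p : ℕ) : 𝓞_ℂ_[p]) ^ k * (C ((p : ℕ) : 𝓞_ℂ_[p]) ^ m * x) := by ring
      _ = C c * C d * (Q * g) := by rw [hCd, hg]
      _ = C c * Q * (C d * g) := by ring

/-- **Transport along frames that agree up to non-zero constants**: if `(c·Q) = (c′·Q′)` as ideals of `𝓞_{ℂ_p}⟦T⟧`
with `c, c′ ≠ 0`, the heart's conclusion for `Q` and for `Q′` are equivalent. [folklore] -/
theorem heartShape_iff_of_span_C_mul_eq {c c' : 𝓞_ℂ_[p]} (hc : c ≠ 0) (hc' : c' ≠ 0)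
    {Q Q' : PowerSeries 𝓞_ℂ_[p]}
    (h : Ideal.span ({C c * Q} : Set (PowerSeries 𝓞_ℂ_[p])) = Ideal.span {C c' * Q'})
    (I : Ideal (PowerSeries 𝓞_ℂ_[p])) :
    (∃ m : ℕ, ∀ x ∈ I, (C ((p : ℕ) : 𝓞_ℂ_[p]) : PowerSeries 𝓞_ℂ_[p]) ^ m * x ∈ Ideal.span {Q}) ↔
      (∃ m : ℕ, ∀ x ∈ I, (C ((p : ℕ) : 𝓞_ℂ_[p]) : PowerSeries 𝓞_ℂ_[p]) ^ m * x ∈ Ideal.span {Q'}) := by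
  rw [← heartShape_iff_of_C_mul hc I Q, ← heartShape_iff_of_C_mul hc' I Q', h]

/-- The heart's conclusion for `Q` implies it for every `Q′` dividing `c·Q` with `c ≠ 0` (in particular for every
series generating a LARGER ideal up to a constant). [folklore] -/
theorem heartShape_of_dvd_C_mul {c : 𝓞_ℂ_[p]} (hc : c ≠ 0) {Q Q' : PowerSeries 𝓞_ℂ_[p]}
    (hdvd : Q' ∣ C c * Q) (I : Ideal (PowerSeries 𝓞_ℂ_[p]))
    (hQ : (∃ m : ℕ, ∀ x ∈ I, (C ((p : ℕ) : 𝓞_ℂ_[p]) : PowerSeries 𝓞_ℂ_[p]) ^ m * x ∈ Ideal.span {Q})) :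
    (∃ m : ℕ, ∀ x ∈ I, (C ((p : ℕ) : 𝓞_ℂ_[p]) : PowerSeries 𝓞_ℂ_[p]) ^ m * x ∈ Ideal.span {Q'}) := by
  rw [← heartShape_iff_of_C_mul hc I Q] at hQ
  obtain ⟨m, hm⟩ := hQ
  refine ⟨m, fun x hx ↦ ?_⟩
  exact Ideal.span_singleton_le_span_singleton.mpr hdvd (hm x hx)

/-! ### Appended (lead g0, skeleton v2 sockets): composition of the three layer-2 outputs

The 3-stub refinement of `stub_divHsiehWitness` foreseen in `LAYER2-VOCAB-BRIEF.md` delivers (V3) an inclusion of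
ideals up to a power of `p` (`∃ m′, p^{m′}·I ⊆ J`: the `K′`-side characteristic ideal inside the `L`-side one, read
in `𝓞_{ℂ_p}⟦T⟧`), (V4) the heart shape for `J` and the `L`-side series `Q_L`, and (V2) `(c·Q_L) = (c′·Q_H)` with
`c, c′ ≠ 0`. The lemmas below compose them into the heart shape for `(I, Q_H)` — pure bookkeeping, stated now so
that skeleton v2 is a three-line composition. -/

/-- **Socket composition, ideal side**: if `p^{m′}·I ⊆ J` and `∃ m, p^m·J ⊆ (Q)` then `∃ m, p^m·I ⊆ (Q)`
(`m + m′`). [folklore] -/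
theorem heartShape_of_pow_mul_le {I J : Ideal (PowerSeries 𝓞_ℂ_[p])} {m' : ℕ}
    (hIJ : ∀ x ∈ I, (C ((p : ℕ) : 𝓞_ℂ_[p]) : PowerSeries 𝓞_ℂ_[p]) ^ m' * x ∈ J)
    {Q : PowerSeries 𝓞_ℂ_[p]}
    (hJ : ∃ m : ℕ, ∀ x ∈ J, (C ((p : ℕ) : 𝓞_ℂ_[p]) : PowerSeries 𝓞_ℂ_[p]) ^ m * x ∈ Ideal.span {Q}) :
    ∃ m : ℕ, ∀ x ∈ I, (C ((p : ℕ) : 𝓞_ℂ_[p]) : PowerSeries 𝓞_ℂ_[p]) ^ m * x ∈ Ideal.span {Q} := by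
  obtain ⟨m, hm⟩ := hJ
  refine ⟨m + m', fun x hx ↦ ?_⟩
  have h := hm _ (hIJ x hx)
  rw [pow_add, mul_assoc]
  exact h

/-- **Socket composition, both sides** (skeleton v2 in one line): from (V3) `p^{m′}·I ⊆ J`, (V4) the heart shape
for `(J, Q_L)` and (V2) `(c·Q_L) = (c′·Q_H)` with `c, c′ ∈ 𝓞_{ℂ_p} ∖ 0`, the heart shape for `(I, Q_H)`.
[folklore] -/
theorem heartShape_of_sockets {I J : Ideal (PowerSeries 𝓞_ℂ_[p])} {m' : ℕ}
    (hIJ : ∀ x ∈ I, (C ((p : ℕ) : 𝓞_ℂ_[p]) : PowerSeries 𝓞_ℂ_[p]) ^ m' * x ∈ J)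
    {QL QH : PowerSeries 𝓞_ℂ_[p]} {c c' : 𝓞_ℂ_[p]} (hc : c ≠ 0) (hc' : c' ≠ 0)
    (hspan : Ideal.span ({C c * QL} : Set (PowerSeries 𝓞_ℂ_[p])) = Ideal.span {C c' * QH})
    (hJ : ∃ m : ℕ, ∀ x ∈ J, (C ((p : ℕ) : 𝓞_ℂ_[p]) : PowerSeries 𝓞_ℂ_[p]) ^ m * x ∈ Ideal.span {QL}) :
    ∃ m : ℕ, ∀ x ∈ I, (C ((p : ℕ) : 𝓞_ℂ_[p]) : PowerSeries 𝓞_ℂ_[p]) ^ m * x ∈ Ideal.span {QH} :=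
  (heartShape_iff_of_span_C_mul_eq hc hc' hspan I).mp (heartShape_of_pow_mul_le hIJ hJ)

end Summit.BirchSwinnertonDyer.BirchSwinnertonDyer.Theorems.BiquadraticEisensteinDescentEisensteinHeartFlatCMInertBadKPrimeConstantScaling

end
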